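import Summits.AtomisticToContinuum.Crystallization.Theses.TwoCentreKissingKernel
import Literature.MathematicalPhysics.StatisticalMechanics.LennardJonesClusters
import HarnessLib

/-!
# Birth skeleton (BC3) for crux `BondOrderTwelve` — item stmt-AtomisticToContinuum-12079,
# route `TwoCentreKissingKernel` (rank 4, open-problem class)

Crux (verbatim the route decl, concluded BY NAME below): there is a bond length `a > 0` such that
for every sequence `x N` of Lennard-Jones ground states in `ℝ³` the fraction of particles `i` that
are NOT [`(1-10⁻³)a`-separated from every other particle AND soft-coordinated by exactly twelve
particles within `(1+10⁻³)a`] tends to `0`.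

## The line: GEOMETRY CAPS AT TWELVE, ENERGY PAYS FOR EVERYTHING ELSE

The route's own mechanism sentence ("a soft kissing bound caps the count at 12 (Tammes-13 margin
57.14° < 59.86°), then energy accounting … forces twelve bonds and strain < 10⁻³ away from o(N)
defects") is cut along its one natural seam, potential-free geometry | energy:

* `softKissingTwelve` (L; pure metric geometry, TRUE in print; LEAD RESHAPE 2026-08-17: now PROVED from
  `stub_softKissingUnit` (unit-vector form at inner-product threshold `0.502`, Musin's method re-run) and
  `stub_shellProjection` (elementary radial projection)) — the GAP-FREE SOFT KISSING
  NUMBER at tolerance `10⁻³` is twelve: at most twelve points of `ℝ³` lie in the shell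
  `(1-10⁻³)a ≤ |p - c| ≤ (1+10⁻³)a` with mutual distances `≥ (1-10⁻³)a`.  Radial projection to the
  unit sphere about `c` gives unit vectors at pairwise angle `≥ arccos(1 - (0.999/1.001)²/2) =
  59.868°`, chord `≥ 0.99800`; thirteen such vectors contradict Tammes' `d₁₃ = 57.1367°`
  (Musin–Tarasov 2012, Thm 1 — in tree as the NAMED, unproved fact
  `Literature.Geometry.DiscreteGeometry.musinTarasov2012_tammes_thirteen`, chord threshold `0.957`;
  also below Böröczky–Szabó's hand proof `d₁₃ < 58.7°`).  Strictly between what the tree PROVES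
  (`musin2006_kissing_three_holds`, chord `1`, i.e. `60°`; `maxMinDist_thirteen_lt_one`) and what it
  cites (`0.957`), and NOT the proved gapped bound `gappedKissingBound_proof` (route
  EnergyDerivativeOrder: tolerance `1/400` WITH the gap `√2 - 1/100`; here there is no gap — the second
  distances are free).  Size L: a Delsarte/Bachoc–Vallentin certificate at `59.87°`, slack in Musin's
  LP, or an interval branch-and-bound must be kernel-checked.
* `stub_defectPricing` (XL; the energetic content, a TRANSFER of the crux to a pricing inequality over
  ALL separated finite configurations) — for every separation `δ > 0` there are a bond length `a > 0`,
  a price `c > 0` and a sublinear slack `r N = o(N)` such that EVERY finite `δ`-separated configuration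
  `y` of `N` points satisfies
      `N · e⋆ + c · #{i : the closed soft shell of i is not (1-10⁻³)a-separated, or holds < 12 others}
         - r N ≤ 𝓔_LJ(y)`,
  `e⋆ = ⨅_Q e(Q)` the periodic Lennard-Jones energy per particle (`= lim E(N)/N`, PROVED in tree:
  `CrysEnergyLimit_holds`).  Why easier / what it exposes: no minimality reasoning at all — a
  pointwise-in-configuration inequality, the exact shape in which Theil 2006 / Flatley–Theil 2015
  prove two-dimensional (resp. `V₃`-assisted three-dimensional) crystallization by localisation
  (site energies + a finite-dimensional local minimisation with a strict gap for defective shells +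
  tail control), and the same quantifier shape as the sibling repaired crux
  `SpectralChargeLedger.SummedShellPricing` (stmt-17044).  Fixed tolerance `10⁻³` and `∃ c`: the
  dilation/virial witness that refuted LINEAR-in-tolerance pricing
  (`SpectralChargeLedgerOneMultiplierPricing_refuted`, stmt-17253; elastic energy is quadratic) only
  caps `c ≲ 36·(10⁻³)²·|e⋆| ≈ 2.6·10⁻⁵`, it does not touch a fixed-tolerance `∃ c > 0` statement.

`BondOrderTwelve_of : BondOrderTwelve` is the kernel-checked composition (no `sorry` outside the two
`stub_*`): the PROVED facts `LennardJonesMinimalDistance_holds` (uniform `δ`) and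
`CrysEnergyLimit_holds` (`E(N)/N → e⋆`) turn the pricing into "density of sites whose closed soft
shell is not a separated ≥12-configuration → 0" (`squeeze_zero'`); at every remaining site the soft
kissing stub caps the count at twelve and the shell separation gives the crux's own separation clause,
so the crux's defect set is contained in the priced one (`tendsto_density_mono`).  The hypothesis form
`stub-sigs → BondOrderTwelve` is the sorry-free `example` right above it (an `example`, not a named
theorem: `#h21_check_skeleton` takes the first declaration concluding the crux and admits no inlined
`Prop` binders).

Registered signatures are ONE-LINE and fully qualified; the readable `abbrev`s below are documentation
(definitionally equal to the inlined clauses) and are not used in the registered signatures.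
-/

noncomputable section

namespace Summit.AtomisticToContinuum.Crystallization.Cruxes.BondOrderTwelve.Birth

open Filter Topology
open Literature.MathematicalPhysics.StatisticalMechanics
open Summit.AtomisticToContinuum.Crystallization.Theses.TwoCentreKissingKernel

/-! ## Readable names (documentation only; the registered stubs inline these verbatim) -/

/-- The closed soft first shell of site `i` at bond length `a` (site `i` and the sites within
`(1+10⁻³)a` of it) is `(1-10⁻³)a`-separated. -/
abbrev ShellSeparated (a : ℝ) {N : ℕ} (y : Fin N → EuclideanSpace ℝ (Fin 3)) (i : Fin N) : Prop :=
  ∀ j j' : Fin N, j ≠ j' → dist (y i) (y j) ≤ (1 + 1 / 1000) * a →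
    dist (y i) (y j') ≤ (1 + 1 / 1000) * a → (1 - 1 / 1000) * a ≤ dist (y j) (y j')

/-- Site `i` is TWELVE-BONDED at bond length `a`: its closed soft shell is separated and holds at
least twelve other sites (the priced, energetic notion of a good site). -/
abbrev TwelveBonded (a : ℝ) {N : ℕ} (y : Fin N → EuclideanSpace ℝ (Fin 3)) (i : Fin N) : Prop :=
  ShellSeparated a y i ∧ 12 ≤ Nat.card {j : Fin N // j ≠ i ∧ dist (y i) (y j) ≤ (1 + 1 / 1000) * a}

/-- Site `i` is BOND-GOOD at bond length `a`: verbatim the crux's clause (separated from every other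
site, exactly twelve in the soft shell). -/
abbrev BondGood (a : ℝ) {N : ℕ} (y : Fin N → EuclideanSpace ℝ (Fin 3)) (i : Fin N) : Prop :=
  (∀ j : Fin N, j ≠ i → (1 - 1 / 1000) * a ≤ dist (y i) (y j)) ∧
    Nat.card {j : Fin N // j ≠ i ∧ dist (y i) (y j) ≤ (1 + 1 / 1000) * a} = 12

/-! ## Generic counting glue (proved) -/

/-- Monotonicity of subtype counts on `Fin N`. -/
theorem natCard_subtype_mono {N : ℕ} (P Q : Fin N → Prop) (h : ∀ i, P i → Q i) :
    Nat.card {i : Fin N // P i} ≤ Nat.card {i : Fin N // Q i} := by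
  classical
  simp only [Nat.card_eq_fintype_card]
  exact Fintype.card_subtype_mono P Q h

/-- Density form: a pointwise smaller defect class inherits density `→ 0` (`squeeze_zero`). -/
theorem tendsto_density_mono {P Q : ∀ N : ℕ, Fin N → Prop} (h : ∀ N i, P N i → Q N i)
    (hQ : Filter.Tendsto (fun N : ℕ => (Nat.card {i : Fin N // Q N i} : ℝ) / (N : ℝ))
      Filter.atTop (nhds (0 : ℝ))) :
    Filter.Tendsto (fun N : ℕ => (Nat.card {i : Fin N // P N i} : ℝ) / (N : ℝ))
      Filter.atTop (nhds (0 : ℝ)) := by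
  refine squeeze_zero (fun N => by positivity) (fun N => ?_) hQ
  exact div_le_div_of_nonneg_right (by exact_mod_cast natCard_subtype_mono _ _ (h N))
    (Nat.cast_nonneg N)

/-! ## Registered stubs (the ONLY `sorry`s of the file; one-line, fully qualified signatures) -/

/-- **STUB 1a — soft kissing number twelve, unit-vector form** (L; pure geometry, TRUE: angle
`arccos 0.502 = 59.868°` is above Tammes' `d₁₃ = 57.1367°` and Böröczky–Szabó's `58.7°`).  Every finite
set of unit vectors of `ℝ³` with pairwise inner products `≤ 0.502` has at most twelve elements.  Plan
(lead): re-run the tree's kernel-checked Musin machinery (`KissingNumberThreeProofs`, `n² ≤ S(X) ≤ 12.99 n`)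
at threshold `8225/16384 ≥ 0.502`: cap branch-and-bound at budget `2.84` (offline replica closes with
`485 + 21391 + 1875` boxes), plus the sliver `⟪v,w⟫ ∈ (1/2, 0.50202]` where Musin's `f > 0`: at most five
such `w` per row, each `f ≤ 9/1000`; row bound `10.11 + 0.045 + 2.84 = 12.995 < 13`. -/
theorem stub_softKissingUnit : ∀ T : Finset (EuclideanSpace ℝ (Fin 3)), (∀ v ∈ T, ‖v‖ = 1) → (∀ v ∈ T, ∀ w ∈ T, v ≠ w → inner ℝ v w ≤ (251 / 500 : ℝ)) → T.card ≤ 12 := by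
  sorry

/-- **STUB 1b — shell projection** (S; elementary).  The unit-vector soft kissing bound at inner-product
threshold `0.502` gives the shell form: points `p` with `0.999a ≤ |p - c| ≤ 1.001a` and mutual distances
`≥ 0.999a` project radially (`p ↦ (p - c)/‖p - c‖`, injective on the shell) to unit vectors with pairwise
inner products `≤ (R² + S² - D²)/(2RS) ≤ 0.502` (`R, S ∈ [0.999a, 1.001a]`, `D = 0.999a`; worst case
`R = S = 1.001a`: `1 - (0.999/1.001)²/2 = 0.501996…`). -/
theorem stub_shellProjection : (∀ T : Finset (EuclideanSpace ℝ (Fin 3)), (∀ v ∈ T, ‖v‖ = 1) → (∀ v ∈ T, ∀ w ∈ T, v ≠ w → inner ℝ v w ≤ (251 / 500 : ℝ)) → T.card ≤ 12) → ∀ a : ℝ, 0 < a → ∀ (c : EuclideanSpace ℝ (Fin 3)) (T : Finset (EuclideanSpace ℝ (Fin 3))), (∀ p ∈ T, (1 - 1 / 1000) * a ≤ dist p c ∧ dist p c ≤ (1 + 1 / 1000) * a) → (∀ p ∈ T, ∀ q ∈ T, p ≠ q → (1 - 1 / 1000) * a ≤ dist p q) → T.card ≤ 12 := by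
  sorry

/-- **Gap-free soft kissing number twelve at tolerance `10⁻³`** (the planner's original stub 1, now
PROVED from stubs 1a + 1b): at most twelve points of `ℝ³` lie in the spherical shell of radii
`[(1-10⁻³)a, (1+10⁻³)a]` about a centre `c` with mutual distances `≥ (1-10⁻³)a`. -/
theorem softKissingTwelve : ∀ a : ℝ, 0 < a → ∀ (c : EuclideanSpace ℝ (Fin 3)) (T : Finset (EuclideanSpace ℝ (Fin 3))), (∀ p ∈ T, (1 - 1 / 1000) * a ≤ dist p c ∧ dist p c ≤ (1 + 1 / 1000) * a) → (∀ p ∈ T, ∀ q ∈ T, p ≠ q → (1 - 1 / 1000) * a ≤ dist p q) → T.card ≤ 12 :=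
  stub_shellProjection stub_softKissingUnit

/-- **STUB 2 — defect pricing** (XL; the energetic content).  For every separation `δ > 0` there
are a bond length `a > 0`, a price `c > 0` and a slack `r N = o(N)` such that every finite
`δ`-separated configuration `y` of `N` points in `ℝ³` has Lennard-Jones energy at least
`N · e⋆ + c · #{sites whose closed soft shell at bond length a is not (1-10⁻³)a-separated or holds
fewer than twelve other sites} - r N`, where `e⋆ = ⨅_Q e(Q)` is the periodic minimum energy per
particle (`= lim E(N)/N`, proved: `CrysEnergyLimit_holds`).  Why it might fail: a family of
first-shell defects with excess energy `o(1)` per defective site at FIXED tolerance `10⁻³` (a zero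
mode of the close-packed Lennard-Jones crystal — excluded by phonon stability, cost `≳ 10⁻⁵` per
site — or a positive density of non-twelve-bonded sites in bulk ground states: polytetrahedral /
Frank–Kasper order, barrier IcosahedralClusters), or `a` is not one bond length (hcp in/out split is
`9·10⁻⁵ ≪ 10⁻³`, refuter evidence hcp_lj.py). Only `δ = 1/3` (`LennardJonesMinimalDistance_holds`)
is consumed by the skeleton. -/
theorem stub_defectPricing : ∀ δ : ℝ, 0 < δ → ∃ a c : ℝ, 0 < a ∧ 0 < c ∧ ∃ r : ℕ → ℝ, Filter.Tendsto (fun N : ℕ => r N / (N : ℝ)) Filter.atTop (nhds (0 : ℝ)) ∧ ∀ (N : ℕ) (y : Fin N → EuclideanSpace ℝ (Fin 3)), (∀ i j : Fin N, i ≠ j → δ ≤ dist (y i) (y j)) → (N : ℝ) * (⨅ Q : Literature.MathematicalPhysics.StatisticalMechanics.PeriodicConfiguration 3, Q.energyPerParticle Literature.MathematicalPhysics.StatisticalMechanics.lennardJones) + c * (Nat.card {i : Fin N // ¬ ((∀ j j' : Fin N, j ≠ j' → dist (y i) (y j) ≤ (1 + 1 / 1000) * a → dist (y i) (y j') ≤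 (1 + 1 / 1000) * a → (1 - 1 / 1000) * a ≤ dist (y j) (y j')) ∧ 12 ≤ Nat.card {j : Fin N // j ≠ i ∧ dist (y i) (y j) ≤ (1 + 1 / 1000) * a})} : ℝ) - r N ≤ Literature.MathematicalPhysics.StatisticalMechanics.interactionEnergy Literature.MathematicalPhysics.StatisticalMechanics.lennardJones y := by
  sorry

/-! ## The two proved steps of the composition -/

/-- GEOMETRIC STEP (from stub 1): in an injective configuration, a twelve-bonded site is bond-good —
its shell separation yields the crux's separation clause (take `j' = i`), and the soft kissing bound
applied to the image of its soft shell (a `(1-10⁻³)a`-separated subset of the shell of radii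
`[(1-10⁻³)a, (1+10⁻³)a]` about `y i`) caps the count at twelve. -/
theorem bondGood_of_twelveBonded
    (hK : ∀ a : ℝ, 0 < a → ∀ (c : EuclideanSpace ℝ (Fin 3)) (T : Finset (EuclideanSpace ℝ (Fin 3))), (∀ p ∈ T, (1 - 1 / 1000) * a ≤ dist p c ∧ dist p c ≤ (1 + 1 / 1000) * a) → (∀ p ∈ T, ∀ q ∈ T, p ≠ q → (1 - 1 / 1000) * a ≤ dist p q) → T.card ≤ 12)
    {a : ℝ} (ha : 0 < a) {N : ℕ} {y : Fin N → EuclideanSpace ℝ (Fin 3)} (hy : Function.Injective y)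
    {i : Fin N}
    (hgood : (∀ j j' : Fin N, j ≠ j' → dist (y i) (y j) ≤ (1 + 1 / 1000) * a → dist (y i) (y j') ≤ (1 + 1 / 1000) * a → (1 - 1 / 1000) * a ≤ dist (y j) (y j')) ∧ 12 ≤ Nat.card {j : Fin N // j ≠ i ∧ dist (y i) (y j) ≤ (1 + 1 / 1000) * a}) :
    (∀ j : Fin N, j ≠ i → (1 - 1 / 1000) * a ≤ dist (y i) (y j)) ∧ Nat.card {j : Fin N // j ≠ i ∧ dist (y i) (y j) ≤ (1 + 1 / 1000) * a} = 12 := by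
  classical
  obtain ⟨hs, h12⟩ := hgood
  have hsep_i : ∀ j : Fin N, j ≠ i → (1 - 1 / 1000) * a ≤ dist (y i) (y j) := by
    intro j hj
    by_cases hd : dist (y i) (y j) ≤ (1 + 1 / 1000) * a
    · have h := hs j i hj hd (by rw [dist_self]; positivity)
      rwa [dist_comm] at h
    · push Not at hd
      nlinarith
  refine ⟨hsep_i, le_antisymm ?_ h12⟩
  set T : Finset (EuclideanSpace ℝ (Fin 3)) :=
    (Finset.univ.filter (fun j : Fin N => j ≠ i ∧ dist (y i) (y j) ≤ (1 + 1 / 1000) * a)).image y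
    with hT
  have hcard : T.card = Nat.card {j : Fin N // j ≠ i ∧ dist (y i) (y j) ≤ (1 + 1 / 1000) * a} := by
    rw [hT, Finset.card_image_of_injective _ hy, Nat.card_eq_fintype_card, Fintype.card_subtype]
  rw [← hcard]
  refine hK a ha (y i) T ?_ ?_
  · intro p hp
    rw [hT, Finset.mem_image] at hp
    obtain ⟨j, hj, rfl⟩ := hp
    rw [Finset.mem_filter] at hj
    refine ⟨?_, ?_⟩
    · rw [dist_comm]; exact hsep_i j hj.2.1
    · rw [dist_comm]; exact hj.2.2
  · intro p hp q hq hpq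
    rw [hT, Finset.mem_image] at hp hq
    obtain ⟨j, hj, rfl⟩ := hp
    obtain ⟨j', hj', rfl⟩ := hq
    rw [Finset.mem_filter] at hj hj'
    exact hs j j' (fun h => hpq (by rw [h])) hj.2.2 hj'.2.2

/-- ENERGETIC STEP (from stub 2 at the `δ` of `LennardJonesMinimalDistance_holds`, with the proved
`CrysEnergyLimit_holds`): along ground states `𝓔(x N) = E(N)`, so
`c · #(not twelve-bonded) / N ≤ (E(N)/N - e⋆) + r N / N → 0`. -/
theorem tendsto_density_not_twelveBonded {a c δ : ℝ} (hc : 0 < c)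
    (hsep : ∀ (N : ℕ) (x : Fin N → EuclideanSpace ℝ (Fin 3)), IsGroundState lennardJones x →
      ∀ i j : Fin N, i ≠ j → δ ≤ dist (x i) (x j))
    {r : ℕ → ℝ} (hr : Filter.Tendsto (fun N : ℕ => r N / (N : ℝ)) Filter.atTop (nhds (0 : ℝ)))
    (hprice : ∀ (N : ℕ) (y : Fin N → EuclideanSpace ℝ (Fin 3)), (∀ i j : Fin N, i ≠ j → δ ≤ dist (y i) (y j)) → (N : ℝ) * (⨅ Q : PeriodicConfiguration 3, Q.energyPerParticle lennardJones) + c * (Nat.card {i : Fin N // ¬ ((∀ j j' : Fin N, j ≠ j' → dist (y i) (y j) ≤ (1 + 1 / 1000) * a → dist (y i) (y j') ≤ (1 + 1 / 1000) * a → (1 - 1 / 1000) * a ≤ dist (y j) (y j')) ∧ 12 ≤ Nat.card {j : Fin N // j ≠ i ∧ dist (y i) (y j) ≤ (1 + 1 / 1000) * a})} : ℝ) - r N ≤ interactionEnergy lennardJones y)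
    (x : (N : ℕ) → (Fin N → EuclideanSpace ℝ (Fin 3))) (hx : ∀ N, IsGroundState lennardJones (x N)) :
    Filter.Tendsto (fun N : ℕ => (Nat.card {i : Fin N // ¬ ((∀ j j' : Fin N, j ≠ j' → dist (x N i) (x N j) ≤ (1 + 1 / 1000) * a → dist (x N i) (x N j') ≤ (1 + 1 / 1000) * a → (1 - 1 / 1000) * a ≤ dist (x N j) (x N j')) ∧ 12 ≤ Nat.card {j : Fin N // j ≠ i ∧ dist (x N i) (x N j) ≤ (1 + 1 / 1000) * a})} : ℝ) / (N : ℝ))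
      Filter.atTop (nhds (0 : ℝ)) := by
  set e : ℝ := (⨅ Q : PeriodicConfiguration 3, Q.energyPerParticle lennardJones) with he
  have hlim : Filter.Tendsto (fun N : ℕ => groundStateEnergy lennardJones 3 N / (N : ℝ))
      Filter.atTop (nhds e) := CrysEnergyLimit_holds
  have h1 : Filter.Tendsto
      (fun N : ℕ => ((groundStateEnergy lennardJones 3 N / (N : ℝ) - e) + r N / (N : ℝ)) / c)
      Filter.atTop (nhds (0 : ℝ)) := by
    have h := ((hlim.sub_const e).add hr).div_const c
    rw [sub_self, zero_add, zero_div] at h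
    exact h
  refine squeeze_zero' (Filter.Eventually.of_forall fun N => by positivity) ?_ h1
  filter_upwards [Filter.eventually_gt_atTop 0] with N hN
  have hNpos : (0 : ℝ) < N := by exact_mod_cast hN
  have hp := hprice N (x N) (fun i j hij => hsep N (x N) (hx N) i j hij)
  rw [(hx N).2] at hp
  have key : c * (Nat.card {i : Fin N // ¬ ((∀ j j' : Fin N, j ≠ j' → dist (x N i) (x N j) ≤ (1 + 1 / 1000) * a → dist (x N i) (x N j') ≤ (1 + 1 / 1000) * a → (1 - 1 / 1000) * a ≤ dist (x N j) (x N j')) ∧ 12 ≤ Nat.card {j : Fin N // j ≠ i ∧ dist (x N i) (x N j) ≤ (1 + 1 / 1000) * a})} : ℝ) ≤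
      ((groundStateEnergy lennardJones 3 N / (N : ℝ) - e) + r N / (N : ℝ)) * N := by
    have hexp : ((groundStateEnergy lennardJones 3 N / (N : ℝ) - e) + r N / (N : ℝ)) * N =
        groundStateEnergy lennardJones 3 N - (N : ℝ) * e + r N := by
      field_simp
    rw [hexp]
    linarith
  rw [div_le_div_iff₀ hNpos hc]
  linarith

/-! ## Composition (kernel-checked): the stubs imply the crux BY NAME -/

/-- HYPOTHESIS FORM (BC3 letter; sorry-free): the two stub STATEMENTS imply the crux.  Kept as an
`example` so that `BondOrderTwelve_of` below is the file's first declaration concluding the crux by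
name (the registered form `#h21_check_skeleton` analyses). -/
example : (∀ a : ℝ, 0 < a → ∀ (c : EuclideanSpace ℝ (Fin 3)) (T : Finset (EuclideanSpace ℝ (Fin 3))), (∀ p ∈ T, (1 - 1 / 1000) * a ≤ dist p c ∧ dist p c ≤ (1 + 1 / 1000) * a) → (∀ p ∈ T, ∀ q ∈ T, p ≠ q → (1 - 1 / 1000) * a ≤ dist p q) → T.card ≤ 12) → (∀ δ : ℝ, 0 < δ → ∃ a c : ℝ, 0 < a ∧ 0 < c ∧ ∃ r : ℕ → ℝ, Filter.Tendsto (fun N : ℕ => r N / (N : ℝ)) Filter.atTop (nhds (0 : ℝ)) ∧ ∀ (N : ℕ) (y : Fin N → EuclideanSpace ℝ (Fin 3)), (∀ i j : Fin N, i ≠ j → δ ≤ dist (y i) (y j)) → (N : ℝ) * (⨅ Q : Literature.MathematicalPhysics.StatisticalMechanics.PeriodicConfiguration 3, Q.energyPerParticle Literature.MathematicalPhysics.StatisticalMechanics.lennardJones) + c * (Nat.card {i : Fin N // ¬ ((∀ j j' : Fin N, j ≠ j' → dist (y i) (y j) ≤ (1 + 1 / 1000) * a → dist (y i) (y j') ≤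 (1 + 1 / 1000) * a → (1 - 1 / 1000) * a ≤ dist (y j) (y j')) ∧ 12 ≤ Nat.card {j : Fin N // j ≠ i ∧ dist (y i) (y j) ≤ (1 + 1 / 1000) * a})} : ℝ) - r N ≤ Literature.MathematicalPhysics.StatisticalMechanics.interactionEnergy Literature.MathematicalPhysics.StatisticalMechanics.lennardJones y) → Summit.AtomisticToContinuum.Crystallization.Theses.TwoCentreKissingKernel.BondOrderTwelve := by
  intro hK hE
  obtain ⟨δ, hδ, hsep⟩ := LennardJonesMinimalDistance_holds
  obtain ⟨a, c, ha, hc, r, hr, hprice⟩ := hE δ hδ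
  refine ⟨a, ha, fun x hx => ?_⟩
  exact tendsto_density_mono
    (fun N i hbad hgood => hbad (bondGood_of_twelveBonded hK ha (hx N).1 hgood))
    (tendsto_density_not_twelveBonded hc hsep hr hprice x hx)

/-- THE SKELETON THEOREM (registered form: concludes the route decl `BondOrderTwelve` BY NAME, no
hypotheses, `sorry` only through the two declared `stub_*`). -/
theorem BondOrderTwelve_of : Summit.AtomisticToContinuum.Crystallization.Theses.TwoCentreKissingKernel.BondOrderTwelve := by
  obtain ⟨δ, hδ, hsep⟩ := LennardJonesMinimalDistance_holds
  obtain ⟨a, c, ha, hc, r, hr, hprice⟩ := stub_defectPricing δ hδ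
  refine ⟨a, ha, fun x hx => ?_⟩
  exact tendsto_density_mono
    (fun N i hbad hgood => hbad (bondGood_of_twelveBonded softKissingTwelve ha (hx N).1 hgood))
    (tendsto_density_not_twelveBonded hc hsep hr hprice x hx)

/-! ## Sanity: the readable names ARE the inlined predicates (definitional) -/

example (a : ℝ) {N : ℕ} (y : Fin N → EuclideanSpace ℝ (Fin 3)) (i : Fin N) :
    TwelveBonded a y i ↔ ((∀ j j' : Fin N, j ≠ j' → dist (y i) (y j) ≤ (1 + 1 / 1000) * a → dist (y i) (y j') ≤ (1 + 1 / 1000) * a → (1 - 1 / 1000) * a ≤ dist (y j) (y j')) ∧ 12 ≤ Nat.card {j : Fin N // j ≠ i ∧ dist (y i) (y j) ≤ (1 + 1 / 1000) * a}) := Iff.rfl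

example (a : ℝ) {N : ℕ} (y : Fin N → EuclideanSpace ℝ (Fin 3)) (i : Fin N) :
    BondGood a y i ↔ ((∀ j : Fin N, j ≠ i → (1 - 1 / 1000) * a ≤ dist (y i) (y j)) ∧ Nat.card {j : Fin N // j ≠ i ∧ dist (y i) (y j) ≤ (1 + 1 / 1000) * a} = 12) := Iff.rfl

end Summit.AtomisticToContinuum.Crystallization.Cruxes.BondOrderTwelve.Birth

end
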